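import Mathlib
import Summits.ValiantsHypothesis.ValiantsHypothesis.Theorems.FifoMatchingNNNotVPStubSupportFnHard
import Summits.ValiantsHypothesis.ValiantsHypothesis.Theorems.FifoMatchingNNNotVPSupportFnOfMonotoneCircuit
import HarnessLib

/-!
# Route FifoMatching — crux `NNNotVP` (stmt-ValiantsHypothesis-11615), line `division_split`:
# COROLLARY — nest-free perfect-matching existence needs super-quasipolynomial monotone circuits

The now-proved stub A (`stub_supportFnHard`, `Theorems/FifoMatchingNNNotVPStubSupportFnHard.lean`)
read through g0's equivalence `supportFnHard_iff_circuitSizeOver_lowerBound`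
(`…SupportFnOfMonotoneCircuit`):

* `nfpmExists_monotone_circuitSize_lowerBound` — for every `c`, eventually in `n`, every monotone
  Boolean circuit (basis `{∧₂, ∨₂}`) deciding, on the arc vectors of the ordered point set
  `[2n]`, whether the arcs present contain a NEST-FREE (FIFO) perfect matching — equivalently
  (Grytczuk–Pawlik–Ruciński 2025, Prop. 1) whether an ordered graph contains the matching of a
  shuffle square — has more than `2^{(log₂ n + c)^c}` gates.

(The route to it: CLIQUE-hardness of the function under polynomial monotone projections via the
clique token program, and the tree's Alon–Boppana bound `cliqueSqrt_monotone_lowerBound`; the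
argument actually yields `2^{n^{Ω(1)}}`, only the super-quasipolynomial form is recorded.)
Honest framing: a monotone lower bound (shuffle-square recognition is NP-complete, so no surprise,
but no monotone bound was in the tree or, to our knowledge, in print); the crux `NNNotVP` and
`VP ≠ VNP` stay OPEN (NOT proved).  No definitions, no named facts.
-/

noncomputable section

-- Sub = Summit single-conjunct layout: the duplicated namespace component is mandated by the tree.
set_option linter.dupNamespace false

namespace Summit.ValiantsHypothesis.ValiantsHypothesis.Theorems.FifoMatching.NNNotVP.DivisionSplit

open MvPolynomial Literature.Computability.AlgebraicComplexity
open Literature.Computability.Complexity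
open Literature.Computability.Complexity.GateList
open scoped NNReal BigOperators Classical

/-- **Nest-free perfect-matching existence needs monotone circuits of super-quasipolynomial
size**: for every `c`, for all large `n`, `circuitSizeOver monotoneBasis` of the Boolean function
"the arc set `{a | x a}` of `[2n]` contains a nest-free perfect matching" exceeds
`2^{(log₂ n + c)^c}`. [folklore] -/
theorem nfpmExists_monotone_circuitSize_lowerBound :
    ∀ c : ℕ, ∃ n₀ : ℕ, ∀ n ≥ n₀, 2 ^ ((Nat.log 2 n + c) ^ c) <
      circuitSizeOver monotoneBasis
        (fun x : σ n → Bool => decide (SuppFn (NN n) (Finset.univ.filter fun e => x e = true))) :=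
  supportFnHard_iff_circuitSizeOver_lowerBound.1 stub_supportFnHard

end Summit.ValiantsHypothesis.ValiantsHypothesis.Theorems.FifoMatching.NNNotVP.DivisionSplit

end
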